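import Summits.Schanuel.Schanuel.Theorems.ZilberEacGraphLinearWitness
import HarnessLib

/-!
# The equimodular class, XXV: the witness over a polynomial graph for an ANALYTIC branch datum —
# `y₁ = e^{P̃(τ + 2πik)} · w(1/x₀)` along the exponential points of one branch

HONEST FRAMING.  Cell `pub-schanuel` (Zilber's Exponential-Algebraic Closedness, case ladder;
host summit Schanuel), seat 2, gen 24.  Gen 23 (file XIII, `exists_graph_witness`) treated the
rational branch `e^{x₀} = -B(x₀)/A(x₀)` of a `y₀`-linear fibre.  Here the datum is an arbitrary
function `r` analytic at `0` with `r(0) = 1` (for a fibre curve of higher `y₀`-degree,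
`r(u) = ψ(u)/θ` with `ψ` the analytic branch of file XXIII at a simple top-row root `θ = e^τ`):
**`exists_branch_witness`** — for `p ∈ ℂ[X]` of degree `d ≥ 2` there are `P̃ ∈ ℂ[X]` of degree `d`
with the same two top coefficients as `p`, a zero-free `w` analytic at `0`, and `δ > 0` with
(K1) `w(1/z) = exp(p(z) - P̃(z - log r(1/z)))` for `z ≠ 0` (the polar correction of gen 23 file XI
along `m = log ∘ r`), and (K2) at every `z` with `‖z‖ > 1/δ` and `e^z = θ·r(1/z)` there is `k ∈ ℤ`
with `‖z - τ - 2πik‖ < 1` and `exp(p(z)) = exp(P̃(τ + 2πik))·w(1/z)` EXACTLY.  The transcendence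
/ algebraicity of `w` is NOT decided here (that is the branch-sum argument of file XXVII).
Nothing here is specific to Schanuel's conjecture (neither used nor implied); Mantova–Masser's
question (PLMS 2024 §1 p. 5) and EC(3,2) stay OPEN.
-/

noncomputable section

open Filter Topology Polynomial Complex

set_option linter.dupNamespace false

namespace Summit.Schanuel.Schanuel.Theorems

/-- **The witness for an analytic branch datum.**  See the module docstring.
[cite: MantovaMasser2023, §1 Further remarks, p. 5 (the question, open in general)] (new) -/
theorem exists_branch_witness {θ : ℂ} (τ : ℂ) (hτ : Complex.exp τ = θ)
    {r : ℂ → ℂ} (hr : AnalyticAt ℂ r 0) (hr0 : r 0 = 1) (p : ℂ[X]) (hd : 2 ≤ p.natDegree) :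
    ∃ (Pt : ℂ[X]) (w : ℂ → ℂ) (δ : ℝ), Pt.natDegree = p.natDegree ∧
      Pt.leadingCoeff = p.leadingCoeff ∧ Pt.coeff (p.natDegree - 1) = p.coeff (p.natDegree - 1) ∧
      AnalyticAt ℂ w 0 ∧ (∀ u, w u ≠ 0) ∧ 0 < δ ∧
      (∀ u : ℂ, ‖u‖ < δ → r u ∈ Complex.slitPlane ∧ ‖Complex.log (r u)‖ < 1) ∧
      (∀ z : ℂ, z ≠ 0 →
        w z⁻¹ = Complex.exp (p.eval z - Pt.eval (z - Complex.log (r z⁻¹)))) ∧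
      (∀ z : ℂ, δ⁻¹ < ‖z‖ → Complex.exp z = θ * r z⁻¹ → ∃ k : ℤ,
        ‖z - τ - k * (2 * Real.pi * I)‖ < 1 ∧
        Complex.exp (p.eval z) = Complex.exp (Pt.eval (τ + k * (2 * Real.pi * I))) * w z⁻¹) := by
  classical
  have hθ0 : θ ≠ 0 := by rw [← hτ]; exact Complex.exp_ne_zero τ
  -- the logarithm of the datum
  set Λt : ℂ → ℂ := fun u => Complex.log (r u) with hΛt
  have hΛt_an : AnalyticAt ℂ Λt 0 := hr.clog (by rw [hr0]; exact Complex.one_mem_slitPlane)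
  have hΛt0 : Λt 0 = 0 := by rw [hΛt]; simp [hr0]
  -- the polar correction of `p` along `Λ̃`
  have hd1 : 1 ≤ p.natDegree := le_trans (by norm_num) hd
  obtain ⟨Pt, Rm, hPtdeg, hPtlc, hPtsub, hRm, hpolar⟩ :=
    exists_polar_correction_natDegree hΛt_an hΛt0 p hd1
  set w : ℂ → ℂ := fun u => Complex.exp (Rm u) with hw
  have hw_an : AnalyticAt ℂ w 0 := hRm.cexp
  -- (K1) `w(1/z) = exp(p(z) - P̃(z - Λ(1/z)))`
  have hK1 : ∀ z : ℂ, z ≠ 0 → w z⁻¹ = Complex.exp (p.eval z - Pt.eval (z - Λt z⁻¹)) := by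
    intro z hz
    rw [hw]
    simp only
    congr 1
    have h := hpolar z⁻¹ (inv_ne_zero hz)
    rw [inv_inv] at h
    linear_combination -h
  -- `Λ̃` is small and `r` stays in the slit plane near `0`
  have hsmall : ∀ᶠ u in 𝓝 (0 : ℂ), r u ∈ Complex.slitPlane ∧ ‖Λt u‖ < 1 := by
    have h1 : ∀ᶠ u in 𝓝 (0 : ℂ), r u ∈ Complex.slitPlane :=
      hr.continuousAt.eventually
        (Complex.isOpen_slitPlane.mem_nhds (by rw [hr0]; exact Complex.one_mem_slitPlane))
    have h2 : ∀ᶠ u in 𝓝 (0 : ℂ), ‖Λt u‖ < 1 := by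
      have hc := hΛt_an.continuousAt
      have := hc.eventually (Metric.ball_mem_nhds (Λt 0) one_pos)
      filter_upwards [this] with u hu
      have hu' : dist (Λt u) (Λt 0) < 1 := hu
      rwa [hΛt0, dist_zero_right] at hu'
    exact h1.and h2
  obtain ⟨δ, hδ, hball⟩ := Metric.eventually_nhds_iff_ball.1 hsmall
  have hballu : ∀ u : ℂ, ‖u‖ < δ → r u ∈ Complex.slitPlane ∧ ‖Λt u‖ < 1 := fun u hu =>
    hball u (by rwa [Metric.mem_ball, dist_zero_right])
  have hzinv : ∀ z : ℂ, δ⁻¹ < ‖z‖ → z ≠ 0 ∧ ‖z⁻¹‖ < δ := by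
    intro z hz
    have hzpos : 0 < ‖z‖ := lt_trans (by positivity) hz
    refine ⟨norm_pos_iff.1 hzpos, ?_⟩
    rw [norm_inv]
    calc ‖z‖⁻¹ < (δ⁻¹)⁻¹ := (inv_lt_inv₀ hzpos (by positivity)).2 hz
      _ = δ := inv_inv δ
  refine ⟨Pt, w, δ, hPtdeg, hPtlc, hPtsub, hw_an, fun u => Complex.exp_ne_zero _, hδ, hballu, hK1, ?_⟩
  -- (K2) the exact identity at exponential points of the branch
  intro z hzR hexp
  obtain ⟨hz, hzu⟩ := hzinv z hzR
  obtain ⟨hslit, hΛz⟩ := hballu z⁻¹ hzu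
  have hrz : r z⁻¹ ≠ 0 := Complex.slitPlane_ne_zero hslit
  -- `exp(z - τ - Λ) = 1`
  have h1 : Complex.exp (z - τ - Λt z⁻¹) = 1 := by
    rw [Complex.exp_sub, Complex.exp_sub, hΛt]
    simp only
    rw [Complex.exp_log hrz, hτ, hexp, div_div, div_self (mul_ne_zero hθ0 hrz)]
  obtain ⟨k, hk⟩ := Complex.exp_eq_one_iff.1 h1
  refine ⟨k, ?_, ?_⟩
  · have e : z - τ - k * (2 * Real.pi * I) = Λt z⁻¹ := by linear_combination hk
    rw [e]; exact hΛz
  rw [hK1 z hz, ← Complex.exp_add]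
  congr 1
  have hzΛ : z - Λt z⁻¹ = τ + k * (2 * Real.pi * I) := by linear_combination hk
  rw [hzΛ]
  ring

end Summit.Schanuel.Schanuel.Theorems
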